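import Summits.QuantumFields.YangMills.Theorems.VirialFluxGapFixSliceDefs
import Summits.QuantumFields.YangMills.Theorems.VirialFluxGapFixSplit
import Summits.QuantumFields.YangMills.Theorems.VirialFluxGapAnchorChartMeasure
import Summits.QuantumFields.YangMills.Theorems.VirialFluxGapChartTensor
import Summits.QuantumFields.YangMills.Theorems.VirialFluxGapConjChart
import Summits.QuantumFields.YangMills.Theorems.VirialFluxGapAnchorDensity
import HarnessLib

/-!
# ★★★ THE CHART IDENTITY `hloc` ON THE TREE-GAUGED RING SPACE `X_fix`
# (layer (B2) of the DIRECT Laplace road to ⟨stmt-QuantumFields-24204⟩ `VirialFluxGap.SharpTwistedLaplace`)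

Helper module (free-hands work of width seat ym-line-sfw-p2-w3 g57, cell ym-idea-1; `--supports 24204`).  Assembles the B2 keystone of the
orbit-tube theorem ✓`QuantitativeLaplace.laplaceMethod_quantitative_orbit_tube` on `X_fix` (product-window form): the anchor core
✓`AnchorSlice.haar_prod_restrict_image_anchorMap` ⊗ the conjugated charts of the remaining components ✓`ConjChart.map_pi_conjChart` via
✓`ChartTensor.restrict_image_tensorWindow_eq_map_withDensity`, transported along ✓`FixSplit.measurePreserving_fixSplit`:
* §1 `map_restChart` (★ `restChart R k` pushes `restParamMeasure` to `restMeasure`), `measurable_restChart`, `surjOn_restChart`,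
  `measurable_restChart_param`;
* §2 `fixWindowMap_eq` — `Θ'(z,(a,b)) = fixSplit⁻¹(anchorMap(z,a), restChart R (expPoint z) b)`;
* §3 ★★★ `fix_restrict_image_windowMap` — for `r < π/2`, `R_w < 1`:
  `μ_fix|_{Θ'(closedBall 0 r × (closedBall 0 R_w × univ))} = Θ'_*(anchorDensity(z,a) · (Leb³ ⊗ (Leb³ ⊗ restParamMeasure))|_{window})`,
  `Θ' = fixWindowMap ω_C ω_N ω_× C₀ N₀ R`, `μ_fix = Haar^{off} ⊗ (⊗ configMeasure) ⊗ gaugeMeasure`.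
WHAT REMAINS to feed the orbit theorem literally (memo `w3-g57-ANCHOR-CHART-24204.md` §3): re-parametrise the slice by an inner-product space
`V` (Euclidean coordinates `(a, b) ↦ y`, `restParamMeasure = w_exp-density × Lebesgue` componentwise, ✓`ConjChart.expMeasure_eq_closedBall`), restrict
to `Φ ×ˢ closedBall_V 0 R` (✓`chart_restrict_of_injOn_ofReal`; injectivity from ✓`injOn_anchorMap` + `injOn_expPoint`), and combine the window data
(✓`exists_anchor_window_datum` × ✓`VirialFluxGapProductSincWeight`).
Everything here is PROVED; no definitions, no named facts (namespace `Summit.QuantumFields.YangMills.Theorems.VirialFluxGap.FixSplit`).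
HONEST FRAMING: measure-theoretic plumbing; ⟨24204⟩, ⟨24319⟩ and every rung stay OPEN; the Yang–Mills mass gap (Clay) is NOT touched; no summit is
proved by a line.

## References
* S. Helgason, *Groups and Geometric Analysis* (2000), Ch. I §1 Thm 1.14. [Helgason2000]
* K. W. Breitung, *Asymptotic Approximations for Probability Integrals*, LNM 1592 (1994), §2.3 Definitions 4–5; Thm 41 p. 56. [Breitung1994]
* G. E. Bredon, *Introduction to Compact Transformation Groups* (1972), Ch. II §§4–5. [Bredon1972]
-/

set_option autoImplicit false

noncomputable section

open MeasureTheory Set Filter Metric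
open scoped ENNReal RealInnerProductSpace
open Literature.MathematicalPhysics.QuantumLattice
open Literature.MathematicalPhysics.QuantumFieldTheory hiding SU2
open Literature.MathematicalPhysics.QuantumFieldTheory.Balaban1983to89.T4HaarSU2ExpChart
open Literature.MathematicalPhysics.QuantumFieldTheory.Balaban1983to89.T4ExpWindowSmallField
open Summit.QuantumFields.YangMills.Theorems.FemtoTransferGap
open Summit.QuantumFields.YangMills.Theorems.FemtoTransferGap.TT
open Summit.QuantumFields.YangMills.Theorems.VirialFluxGap.AnchorSlice
open Summit.QuantumFields.YangMills.Theorems.VirialFluxGap.ConjChart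
open Summit.QuantumFields.YangMills.Theorems.VirialFluxGap.ChartTensor

namespace Summit.QuantumFields.YangMills.Theorems.VirialFluxGap.FixSplit

variable {L : ℕ} [NeZero L]


variable {e₀ : OffIdx L} {y₀ : Site 3 L}

/-! ## §1 The conjugated charts of the remaining components are full charts -/

/-- ★ `restChart R k` pushes the product chart law `restParamMeasure` to `restMeasure` (✓`ConjChart.map_pi_conjChart` per factor). [folklore] -/
theorem map_restChart (R : FixRest L e₀ y₀) (k : SU2) :
    (restParamMeasure L e₀ y₀).map (restChart R k) = restMeasure L e₀ y₀ := by
  have hm : ∀ R₀ : SU2, Measurable (fun b : EuclideanSpace ℝ (Fin 3) => k * (expPoint b * R₀) * k⁻¹) := fun R₀ =>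
    ((continuous_const.mul (continuous_expPoint.mul continuous_const)).mul continuous_const).measurable
  have h1 : MeasurePreserving (fun b : {i : OffIdx L // ¬ i = e₀} → EuclideanSpace ℝ (Fin 3) => fun i => k * (expPoint (b i) * R.1 i) * k⁻¹)
      (Measure.pi fun _ => expMeasure) (Measure.pi fun _ => haarProbability SU2) :=
    ⟨measurable_pi_lambda _ fun i => (hm (R.1 i)).comp (measurable_pi_apply i), map_pi_conjChart k R.1⟩
  have h2 : MeasurePreserving (fun b : Fin (2 * L - 1) → Edge 3 L → EuclideanSpace ℝ (Fin 3) =>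
      fun j e => k * (expPoint (b j e) * R.2.1 j e) * k⁻¹)
      (Measure.pi fun _ => Measure.pi fun _ => expMeasure) (Measure.pi fun _ => configMeasure SU2 L) := by
    have h := measurePreserving_pi (fun _ : Fin (2 * L - 1) => Measure.pi fun _ : Edge 3 L => expMeasure)
      (fun _ : Fin (2 * L - 1) => configMeasure SU2 L)
      (f := fun j (c : Edge 3 L → EuclideanSpace ℝ (Fin 3)) => fun e => k * (expPoint (c e) * R.2.1 j e) * k⁻¹)
      (fun j => ⟨measurable_pi_lambda _ fun e => (hm (R.2.1 j e)).comp (measurable_pi_apply e), by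
        unfold configMeasure; exact map_pi_conjChart k (R.2.1 j)⟩)
    exact h
  have h3 : MeasurePreserving (fun b : {y : Site 3 L // ¬ y = y₀} → EuclideanSpace ℝ (Fin 3) => fun y => k * (expPoint (b y) * R.2.2 y) * k⁻¹)
      (Measure.pi fun _ => expMeasure) (Measure.pi fun _ => haarProbability SU2) :=
    ⟨measurable_pi_lambda _ fun y => (hm (R.2.2 y)).comp (measurable_pi_apply y), map_pi_conjChart k R.2.2⟩
  have h := h1.prod (h2.prod h3)
  rw [restParamMeasure, restMeasure]
  exact h.map_eq

/-- `restChart R k` is measurable. [folklore] -/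
theorem measurable_restChart (R : FixRest L e₀ y₀) (k : SU2) : Measurable (restChart R k) := by
  have h := (map_restChart R k)
  have hm : ∀ R₀ : SU2, Measurable (fun b : EuclideanSpace ℝ (Fin 3) => k * (expPoint b * R₀) * k⁻¹) := fun R₀ =>
    ((continuous_const.mul (continuous_expPoint.mul continuous_const)).mul continuous_const).measurable
  exact (measurable_pi_lambda _ fun i => (hm (R.1 i)).comp ((measurable_pi_apply i).comp measurable_fst)).prodMk
    ((measurable_pi_lambda _ fun j => measurable_pi_lambda _ fun e =>
        (hm (R.2.1 j e)).comp ((measurable_pi_apply e).comp ((measurable_pi_apply j).comp (measurable_fst.comp measurable_snd)))).prodMk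
      (measurable_pi_lambda _ fun y => (hm (R.2.2 y)).comp ((measurable_pi_apply y).comp (measurable_snd.comp measurable_snd))))

omit [NeZero L] in
/-- `restChart R k` is onto (✓`expPoint_surjective`). [folklore] -/
theorem surjOn_restChart (R : FixRest L e₀ y₀) (k : SU2) : SurjOn (restChart R k) univ univ := by
  rintro ⟨r₁, f, r₃⟩ -
  have key : ∀ R₀ U : SU2, ∃ b : EuclideanSpace ℝ (Fin 3), k * (expPoint b * R₀) * k⁻¹ = U := by
    intro R₀ U
    obtain ⟨b, hb⟩ := expPoint_surjective (k⁻¹ * U * k * R₀⁻¹)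
    exact ⟨b, by rw [hb]; group⟩
  choose b₁ hb₁ using fun i => key (R.1 i) (r₁ i)
  choose b₂ hb₂ using fun j e => key (R.2.1 j e) (f j e)
  choose b₃ hb₃ using fun y => key (R.2.2 y) (r₃ y)
  refine ⟨(b₁, (b₂, b₃)), mem_univ _, ?_⟩
  simp only [restChart]
  refine Prod.ext (funext fun i => hb₁ i) (Prod.ext (funext fun j => funext fun e => hb₂ j e) (funext fun y => hb₃ y))

/-! ## §2 The window map factors through the splitting -/

omit [NeZero L] in
/-- The window map is the split-back of `(anchorMap, restChart)`: `Θ'(z, (a, b)) = fixSplit⁻¹ (anchorMap (z, a), restChart R (expPoint z) b)`.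
[folklore] -/
theorem fixWindowMap_eq (ωC ωN ωX : EuclideanSpace ℝ (Fin 3)) (C₀ N₀ : SU2) (R : FixRest L e₀ y₀)
    (w : EuclideanSpace ℝ (Fin 3) × (EuclideanSpace ℝ (Fin 3) × RestParam L e₀ y₀)) :
    fixWindowMap ωC ωN ωX C₀ N₀ R w =
      (fixSplit L e₀ y₀).symm (anchorMap ωC ωN ωX C₀ N₀ (w.1, w.2.1), restChart R (expPoint w.1) w.2.2) := by
  apply (fixSplit L e₀ y₀).injective
  rw [MeasurableEquiv.apply_symm_apply]
  unfold fixWindowMap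
  rw [fixSplit_conj]
  unfold fixSlice
  set p := ((seamSlice ωC C₀ (w.2.1 0), linkSlice ωN ωX N₀ (w.2.1 1) (w.2.1 2)), restChart R 1 w.2.2) with hp
  have e1 : ((fixSplit L e₀ y₀).symm p).2.2 y₀ = p.1.1 := by
    show (if h : y₀ = y₀ then p.1.1 else p.2.2.2 ⟨y₀, h⟩) = p.1.1; simp
  have e2 : ((fixSplit L e₀ y₀).symm p).1 e₀ = p.1.2 := by
    show (if h : e₀ = e₀ then p.1.2 else p.2.1 ⟨e₀, h⟩) = p.1.2; simp
  have e3 : ∀ i : {i : OffIdx L // ¬ i = e₀}, ((fixSplit L e₀ y₀).symm p).1 i.1 = p.2.1 i := fun i => by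
    show (if h : i.1 = e₀ then p.1.2 else p.2.1 ⟨i.1, h⟩) = p.2.1 i; simp [i.2]
  have e4 : ((fixSplit L e₀ y₀).symm p).2.1 = p.2.2.1 := rfl
  have e5 : ∀ y : {y : Site 3 L // ¬ y = y₀}, ((fixSplit L e₀ y₀).symm p).2.2 y.1 = p.2.2.2 y := fun y => by
    show (if h : y.1 = y₀ then p.1.1 else p.2.2.2 ⟨y.1, h⟩) = p.2.2.2 y; simp [y.2]
  rw [e1, e2, e4]
  refine Prod.ext rfl (Prod.ext ?_ (Prod.ext ?_ ?_))
  · funext i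
    dsimp only
    rw [e3]
    show expPoint w.1 * (1 * (expPoint (w.2.2.1 i) * R.1 i) * 1⁻¹) * (expPoint w.1)⁻¹ = expPoint w.1 * (expPoint (w.2.2.1 i) * R.1 i) * (expPoint w.1)⁻¹
    rw [one_mul, inv_one, mul_one]
  · funext j e
    dsimp only
    show expPoint w.1 * (1 * (expPoint (w.2.2.2.1 j e) * R.2.1 j e) * 1⁻¹) * (expPoint w.1)⁻¹ =
      expPoint w.1 * (expPoint (w.2.2.2.1 j e) * R.2.1 j e) * (expPoint w.1)⁻¹
    rw [one_mul, inv_one, mul_one]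
  · funext y
    dsimp only
    rw [e5]
    show expPoint w.1 * (1 * (expPoint (w.2.2.2.2 y) * R.2.2 y) * 1⁻¹) * (expPoint w.1)⁻¹ = expPoint w.1 * (expPoint (w.2.2.2.2 y) * R.2.2 y) * (expPoint w.1)⁻¹
    rw [one_mul, inv_one, mul_one]

omit [NeZero L] in
/-- The parametrised rest chart `(z, b) ↦ restChart R (expPoint z) b` is jointly measurable. [folklore] -/
theorem measurable_restChart_param (R : FixRest L e₀ y₀) :
    Measurable (fun q : EuclideanSpace ℝ (Fin 3) × RestParam L e₀ y₀ => restChart R (expPoint q.1) q.2) := by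
  have hk : Measurable fun q : EuclideanSpace ℝ (Fin 3) × RestParam L e₀ y₀ => expPoint q.1 := measurable_expPoint.comp measurable_fst
  have hc : ∀ {f : EuclideanSpace ℝ (Fin 3) × RestParam L e₀ y₀ → EuclideanSpace ℝ (Fin 3)} (R₀ : SU2), Measurable f →
      Measurable fun q => expPoint q.1 * (expPoint (f q) * R₀) * (expPoint q.1)⁻¹ := fun R₀ hf =>
    (hk.mul ((measurable_expPoint.comp hf).mul measurable_const)).mul hk.inv
  unfold restChart
  refine (measurable_pi_lambda _ fun i => hc (R.1 i) ((measurable_pi_apply i).comp (measurable_fst.comp measurable_snd))).prodMk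
    ((measurable_pi_lambda _ fun j => measurable_pi_lambda _ fun e => hc (R.2.1 j e)
      ((measurable_pi_apply e).comp ((measurable_pi_apply j).comp (measurable_fst.comp (measurable_snd.comp measurable_snd))))).prodMk
      (measurable_pi_lambda _ fun y => hc (R.2.2 y) ((measurable_pi_apply y).comp (measurable_snd.comp (measurable_snd.comp measurable_snd)))))

/-! ## §3 The chart identity `hloc` on the tree-gauged ring space -/

/-- ★★★ **THE CHART IDENTITY `hloc` ON `X_fix`** (product window): for `r < π/2`, `R_w < 1`,
`μ_fix|_{Θ'(Φ × (B₁ × univ))} = Θ'_*((anchorDensity(z, a)) · (Leb³ ⊗ (Leb³ ⊗ restParamMeasure))|_{Φ×(B₁×univ)})`,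
`Φ = closedBall 0 r`, `B₁ = closedBall 0 R_w`, `Θ' = fixWindowMap` — the anchor core (✓`haar_prod_restrict_image_anchorMap`) tensored with the
conjugated charts of the remaining components (✓`ChartTensor`, ✓`ConjChart`) and transported along the splitting (✓`measurePreserving_fixSplit`).
[cite: Helgason2000, Ch. I §1 Thm 1.14] [cite: Breitung1994, §2.3 Definitions 4–5; Thm 41 p. 56] [cite: Bredon1972, Ch. II §§4–5] -/
theorem fix_restrict_image_windowMap {ωC ωN ωX : EuclideanSpace ℝ (Fin 3)} {C₀ N₀ : SU2} (hC : ‖ωC‖ = 1) (hN : ‖ωN‖ = 1)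
    (hCN : ⟪ωC, ωN⟫ = 0) (hX : imQuat ωX = imQuat ωC * imQuat ωN) (hC₀ : su2Quat C₀ = imQuat ωC)
    (hN₀ : su2Quat N₀ = imQuat ωN ∨ su2Quat N₀ = -imQuat ωN) (R : FixRest L e₀ y₀) {r Rw : ℝ} (hr : r < Real.pi / 2) (hRw : Rw < 1) :
    ((Measure.pi fun _ : OffIdx L => haarProbability SU2).prod
        ((Measure.pi fun _ : Fin (2 * L - 1) => configMeasure SU2 L).prod (gaugeMeasure L))).restrict
        (fixWindowMap ωC ωN ωX C₀ N₀ R ''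
          (closedBall (0 : EuclideanSpace ℝ (Fin 3)) r ×ˢ (closedBall (0 : EuclideanSpace ℝ (Fin 3)) Rw ×ˢ (univ : Set (RestParam L e₀ y₀))))) =
      ((((volume : Measure (EuclideanSpace ℝ (Fin 3))).prod
          ((volume : Measure (EuclideanSpace ℝ (Fin 3))).prod (restParamMeasure L e₀ y₀))).restrict
          (closedBall (0 : EuclideanSpace ℝ (Fin 3)) r ×ˢ (closedBall (0 : EuclideanSpace ℝ (Fin 3)) Rw ×ˢ (univ : Set (RestParam L e₀ y₀))))).withDensity
        fun w => ENNReal.ofReal (anchorDensity ωC ωN ωX C₀ N₀ (w.1, w.2.1))).map (fixWindowMap ωC ωN ωX C₀ N₀ R) := by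
  haveI : IsProbabilityMeasure (gaugeMeasure L) := by unfold gaugeMeasure; infer_instance
  haveI : SigmaFinite (restMeasure L e₀ y₀) := by unfold restMeasure; infer_instance
  haveI : SFinite (restParamMeasure L e₀ y₀) := by unfold restParamMeasure; infer_instance
  -- the parametrised rest chart, uncurried (kept folded: `Function.uncurry` is never unfolded by the kernel here)
  set c : EuclideanSpace ℝ (Fin 3) × RestParam L e₀ y₀ → FixRest L e₀ y₀ :=
    Function.uncurry fun (z : EuclideanSpace ℝ (Fin 3)) (b : RestParam L e₀ y₀) => restChart R (expPoint z) b with hc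
  have hcm : Measurable c := measurable_restChart_param R
  have hcz : ∀ z : EuclideanSpace ℝ (Fin 3), (fun y₂ : RestParam L e₀ y₀ => c (z, y₂)) = restChart R (expPoint z) := fun z => rfl
  -- the tensored identity on `(SU2 × SU2) × FixRest`
  have hT := restrict_image_tensorWindow_eq_map_withDensity
    (κ := (volume : Measure (EuclideanSpace ℝ (Fin 3)))) (ρ₁ := (volume : Measure (EuclideanSpace ℝ (Fin 3))))
    (ρ₂ := restParamMeasure L e₀ y₀) (μ₁ := (haarProbability SU2).prod (haarProbability SU2)) (μ₂ := restMeasure L e₀ y₀)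
    (Θ₁ := anchorMap ωC ωN ωX C₀ N₀) (c := c)
    (Φ := closedBall (0 : EuclideanSpace ℝ (Fin 3)) r) (B₁ := closedBall (0 : EuclideanSpace ℝ (Fin 3)) Rw)
    (B₂ := (univ : Set (RestParam L e₀ y₀)))
    continuous_anchorMap.measurable hcm measurableSet_closedBall measurableSet_closedBall MeasurableSet.univ
    (J₁ := fun w => ENNReal.ofReal (anchorDensity ωC ωN ωX C₀ N₀ w))
    (measurable_anchorDensity (ωC := ωC) (ωN := ωN) (ωX := ωX) (C₀ := C₀) (N₀ := N₀)).ennreal_ofReal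
    (J₂ := fun _ => (1 : ℝ≥0∞)) measurable_const
    (haar_prod_restrict_image_anchorMap hC hN hCN hX hC₀ hN₀ hr hRw)
    (fun z _ => by
      rw [hcz z, Measure.restrict_univ, show (fun _ : RestParam L e₀ y₀ => (1 : ℝ≥0∞)) = 1 from rfl, withDensity_one]
      exact map_restChart R (expPoint z))
    (fun z _ => by rw [hcz z]; exact surjOn_restChart R (expPoint z))
  -- transport along `fixSplit.symm`
  have hpres : MeasurePreserving (fixSplit L e₀ y₀).symm (((haarProbability SU2).prod (haarProbability SU2)).prod (restMeasure L e₀ y₀))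
      ((Measure.pi fun _ : OffIdx L => haarProbability SU2).prod
        ((Measure.pi fun _ : Fin (2 * L - 1) => configMeasure SU2 L).prod (gaugeMeasure L))) :=
    (measurePreserving_fixSplit (L := L) e₀ y₀).symm (fixSplit L e₀ y₀)
  have hA : Measurable (anchorMap ωC ωN ωX C₀ N₀) := continuous_anchorMap.measurable
  have hΘp : Measurable (fun w : EuclideanSpace ℝ (Fin 3) × (EuclideanSpace ℝ (Fin 3) × RestParam L e₀ y₀) =>
      (anchorMap ωC ωN ωX C₀ N₀ (w.1, w.2.1), c (w.1, w.2.2))) :=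
    (Measurable.comp (g := anchorMap ωC ωN ωX C₀ N₀) hA (measurable_fst.prodMk (measurable_fst.comp measurable_snd))).prodMk
      (Measurable.comp (g := c) hcm (measurable_fst.prodMk (measurable_snd.comp measurable_snd)))
  have hcomp : fixWindowMap ωC ωN ωX C₀ N₀ R =
      (fixSplit L e₀ y₀).symm ∘ (fun w : EuclideanSpace ℝ (Fin 3) × (EuclideanSpace ℝ (Fin 3) × RestParam L e₀ y₀) =>
        (anchorMap ωC ωN ωX C₀ N₀ (w.1, w.2.1), c (w.1, w.2.2))) :=
    funext fun w => fixWindowMap_eq ωC ωN ωX C₀ N₀ R w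
  rw [← hpres.map_eq, hcomp, image_comp, MeasurableEquiv.restrict_map, (fixSplit L e₀ y₀).symm.injective.preimage_image, hT,
    Measure.map_map (fixSplit L e₀ y₀).symm.measurable hΘp]
  congr 1
  refine withDensity_congr_ae (Filter.Eventually.of_forall fun w => ?_)
  simp only [mul_one]

end Summit.QuantumFields.YangMills.Theorems.VirialFluxGap.FixSplit

end
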